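import Summits.Ventures.LatticeQCDFlow.Scaling.SectorExactHubDominationLaw
import Summits.Ventures.LatticeQCDFlow.Scaling.DominatedStarRegimeFreeRelaxation
import Literature.Probability.MarkovChains.TvDistanceDecayRate

/-!
HONEST FRAMING: exact (Metropolis-corrected) sampling algorithms for lattice gauge theory; figures
of merit are autocorrelation/cost numbers at stated couplings and volumes; no continuum-physics
claim.

# SectorExactManySectorsLaw — ITEM 1 FOR PARTITION-EXACT FLOWS WITH ANY NUMBER OF SECTORS, UP TO THE LABEL ENTROPY:
# `d(n) ≤ ((θ+K)/θ)(1−δ)^{⌊n/2⌋} + (1 − p·min{ct/(3m), h/(7K)})ⁿ/(2π̃^L_min)` AND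
# `t_mix(ε) ≤ max{2⌈ρ⁻¹·log(2(1+K(2t+h)/(2t))/ε)⌉, ⌈(p·min{ct/(3m), h/(7K)})⁻¹·log(1/(ε·π̃^L_min))⌉}` — FREE OF `|S|`, OF `π̃_min` AND OF ANY
# REGIME; `π̃^L_min` IS THE LEAST STATIONARY MASS OF A LABEL CONFIGURATION (lean-2 GEN-30, ours)

Venture-side (OURS).  Cell `lqcd-flow` (pub-lqcd), unit `pub-lqcd-lean-2-g30`, 2026-08-28.  Chapter Q (item 1 for sector-exact maps on a
general `S`), file 14.  `Scaling/SectorExactHubDominationLaw` reduces the cold-start law of the persistent hub with flows exact on every sector of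
a partition `ℓ : S → L` to that of the `q`-POINT LABEL STAR on `L` (`q = |L|`) plus the stale mass `((θ+K)/θ)(1−δ)^{⌊n/2⌋}`, under the domination
constant alone.  For `q = 2` chapter P closes the label star by coupling; for `q ≥ 3` the coupling route is open (OPEN-MATH GEN-30 addendum).  Here
the label star is bounded SPECTRALLY instead: it is itself a chapter-M scheme (state space `L`, identity entry maps, exact hot redraw, idle cold
labels, one-sided domination = hub domination of the label laws), so chapter N's REGIME-FREE absolute gap
`γ⋆ ≥ p·min{ct/(3m), h/(7K)}` (`Scaling/DominatedStarRegimeFreeRelaxation`) and LPW (12.13) give `d_L(n) ≤ (1 − p·min{ct/(3m), h/(7K)})ⁿ/(2π̃^L_min)`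
with `π̃^L_min` the least stationary mass of a LABEL configuration — at most `(K+1)·log(1/min_{k,b} μ_k(ℓ = b))` in the logarithm, a quantity
of the sector weights and `K` only.

## What is proved

* `labelStar_basic` (the label laws are positive probability vectors, the label kernels row-stochastic and reversible, hub domination of the label
  laws from `p·c_r(b) ≤ 1`); **`labelStar_worstTvDist_le_dom`** — `d_L(n) ≤ (1 − p·min{ct/(3m), (1−t)w_0/(7K)})ⁿ/(2π̃^L_min)` (`|L| ≥ 2`, `K ≥ 1`,
  `c ≥ 1`, `0 < p ≤ 1`, `0 < t < 1`, `w_0 > 0`);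
* **`sectorExact_worstTvDist_le_manySectors`** — for partition-exact flows with labels `ℓ : S → L` (`p·c_r(b) ≤ 1`), exact hot redraws, stationary
  sector-confined cold kernels, `0 < θ ≤ 1`, `(1−θ)t ≤ (1−t)w_0θ`:
  **`d(n) ≤ ((θ+K)/θ)(1 − min{(1−t)w_0(1−θ)pct/m, ((1−t)w_0θ−(1−θ)t)/(K+θ)})^{⌊n/2⌋} + (1 − p·min{ct/(3m), (1−t)w_0/(7K)})ⁿ/(2π̃^L_min)`**;
* **`sectorExact_mixingTime_le_manySectors`** (`θ = 2t/(2t+h)`):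
  **`t_mix(ε) ≤ max{2⌈ρ⁻¹·log(2(1+K(2t+h)/(2t))/ε)⌉, ⌈(p·min{ct/(3m), h/(7K)})⁻¹·log(1/(ε·π̃^L_min))⌉}`**, `ρ = (th/(2t+h))·min{hpc/m, 1/(K+1)}`.

Reading (no numerics implied): for the topological-freezing use case with ANY number of sectors — within-sector samplers on the cold replicas, a
flow hub exact within each sector and under-weighting no sector by more than the factor `p` — the worst-start mixing time is
`O((K + m/(hpc))(1/t+1/h)·log(K/ε) + (m/(ctp) + K/(hp))·(K·log(1/w_min) + log(1/ε)))`, `w_min` the least sector weight among the laws: polynomial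
in `K`, linear in `1/p`, free of `|S|`, of `π̃_min` and of any regime.  What OPEN-MATH item 1 still asks for `q ≥ 3` is the removal of the label
entropy `K·log(1/w_min)` (the `q`-point star's own cold-start law by coupling).  NOT CLAIMED: flows inexact within a sector; anything measured.
Literature grade (cell rule): OWN; cites the tree's LPW (12.13) (`worstTvDist_le_lambdaStar_pow_div`); no new bib keys.
-/

noncomputable section

open Finset Function
open Literature.Probability.MarkovChains

namespace Summit.Ventures.LatticeQCDFlow.Scaling

variable {S : Type*} [Fintype S] [DecidableEq S] {K m : ℕ} {μ : Fin (K + 1) → S → ℝ} {M : Fin (K + 1) → S → S → ℝ}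
  {w : Fin (K + 1) → ℝ} {t : ℝ}

section ManySectors
variable (κ : Fin m → Fin K) (φ : Fin m → Equiv.Perm S) {L : Type*} [Fintype L] [DecidableEq L] (ℓ : S → L)

omit [DecidableEq S] in
/-- The label laws are positive probability vectors, the label kernels (exact hot redraw, idle cold labels) are row-stochastic and reversible, the
hot one is the exact redraw, and `p·c_r(b) ≤ 1` gives hub domination of the label laws along every entry. [ours] -/
theorem labelStar_basic (hμ1 : ∀ k, ∑ u, μ k u = 1) (hφℓ : ∀ r u, ℓ (φ r u) = ℓ u) {cL : Fin m → L → ℝ}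
    (hexact : ∀ r u, μ (κ r).succ (φ r u) = cL r (ℓ u) * μ 0 u)
    {μB : Fin (K + 1) → L → ℝ} (hμB : ∀ k b, μB k b = ∑ u ∈ univ.filter (fun u => ℓ u = b), μ k u) (hμB0 : ∀ k b, 0 < μB k b)
    {p : ℝ} (hpc : ∀ r b, p * cL r b ≤ 1) :
    (∀ k, ∑ b, μB k b = 1)
    ∧ (∀ k, IsRowStochastic ((fun (k : Fin (K + 1)) (u v : L) => if k = 0 then μB 0 v else (if u = v then (1 : ℝ) else 0)) k))
    ∧ (∀ k, DetailedBalance (μB k) ((fun (k : Fin (K + 1)) (u v : L) => if k = 0 then μB 0 v else (if u = v then (1 : ℝ) else 0)) k))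
    ∧ (∀ u v, (fun (k : Fin (K + 1)) (u v : L) => if k = 0 then μB 0 v else (if u = v then (1 : ℝ) else 0)) 0 u v = μB 0 v)
    ∧ (∀ (r : Fin m) (b : L), p * μB (κ r).succ ((fun _ : Fin m => Equiv.refl L) r b) ≤ μB 0 b) := by
  have h1 : ∀ k, ∑ b, μB k b = 1 := by
    intro k
    simp_rw [hμB]
    rw [Finset.sum_fiberwise univ ℓ (fun u => μ k u)]
    exact hμ1 k
  refine ⟨h1, fun k => ⟨fun u v => ?_, fun u => ?_⟩, fun k => ?_, fun u v => by simp, fun r b => ?_⟩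
  · dsimp only; split_ifs; exacts [(hμB0 0 v).le, zero_le_one, le_rfl]
  · dsimp only
    by_cases hk : k = 0
    · simp only [hk, if_true]; exact h1 0
    · simp only [hk, if_false]; rw [Finset.sum_ite_eq univ u, if_pos (mem_univ _)]
  · intro u v
    dsimp only
    by_cases hk : k = 0
    · subst hk; simp only [if_true]; ring
    · simp only [hk, if_false]
      by_cases huv : u = v
      · subst huv; rfl
      · rw [if_neg huv, if_neg (Ne.symm huv), mul_zero, mul_zero]
  · simp only [Equiv.refl_apply]
    rw [hμB, hμB, sectorExact_labelMass κ φ ℓ hφℓ hexact r b]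
    have hX : 0 < ∑ u ∈ univ.filter (fun u => ℓ u = b), μ 0 u := by rw [← hμB]; exact hμB0 0 b
    calc p * (cL r b * ∑ u ∈ univ.filter (fun u => ℓ u = b), μ 0 u)
        = (p * cL r b) * ∑ u ∈ univ.filter (fun u => ℓ u = b), μ 0 u := by ring
      _ ≤ 1 * ∑ u ∈ univ.filter (fun u => ℓ u = b), μ 0 u := mul_le_mul_of_nonneg_right (hpc r b) hX.le
      _ = _ := one_mul _

omit [Fintype S] [DecidableEq S] in
/-- **THE LABEL STAR'S DISTANCE, SPECTRALLY:** the label star on `L` (`|L| ≥ 2`; positive label laws summing to one with hub domination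
`p·μ^L_{κ_r+1} ≤ μ^L_0`, `0 < p ≤ 1`; identity maps; exact hot redraw; idle cold labels; `K ≥ 1`, `c ≥ 1`, `0 < t < 1`, `w_0 > 0`) has
**`d_L(n) ≤ (1 − p·min{ct/(3m), (1−t)w_0/(7K)})ⁿ/(2π̃^L_min)`** for every `0 < π̃^L_min ≤ min_s Π_k μ^L_k(s_k)` — chapter N's regime-free absolute gap
(`Scaling/DominatedStarRegimeFreeRelaxation`) and LPW (12.13). [ours] -/
theorem labelStar_worstTvDist_le_dom [Nontrivial L] (hK : 1 ≤ K) (hm : 1 ≤ m) (ht0 : 0 < t) (ht1 : t < 1) (hw0 : ∀ k, 0 ≤ w k)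
    (hw00 : 0 < w 0) (hw1 : ∑ k, w k = 1) {μB : Fin (K + 1) → L → ℝ} (hμB0 : ∀ k b, 0 < μB k b) (hμB1 : ∀ k, ∑ b, μB k b = 1)
    {p : ℝ} (hp0 : 0 < p) (hp1 : p ≤ 1) (hdomB : ∀ (r : Fin m) (b : L), p * μB (κ r).succ ((fun _ : Fin m => Equiv.refl L) r b) ≤ μB 0 b)
    {c : ℕ} (hc1 : 1 ≤ c) (hc : ∀ p' : Fin K, c ≤ (univ.filter (fun r : Fin m => κ r = p')).card)
    {πLmin : ℝ} (hmin0 : 0 < πLmin) (hmin : ∀ s, πLmin ≤ tensorFun μB s) (n : ℕ) :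
    worstTvDist (fun y s : Fin (K + 1) → L =>
        t * ptGraphSwap μB (fun r : Fin m => (((0 : Fin (K + 1)), (κ r).succ) : Fin (K + 1) × Fin (K + 1)))
            (fun _ : Fin m => Equiv.refl L) y s
          + (1 - t) * prodKernel w (fun (k : Fin (K + 1)) (u v : L) => if k = 0 then μB 0 v else (if u = v then (1 : ℝ) else 0)) y s)
      (tensorFun μB) n
      ≤ (1 - p * min (c * t / (3 * m)) ((1 - t) * w 0 / (7 * K))) ^ n / (2 * πLmin) := by
  set MB : Fin (K + 1) → L → L → ℝ := fun k u v => if k = 0 then μB 0 v else (if u = v then (1 : ℝ) else 0) with hMB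
  have hMBs : ∀ k, IsRowStochastic (MB k) := fun k => by
    refine ⟨fun u v => ?_, fun u => ?_⟩
    · rw [hMB]; dsimp only; split_ifs; exacts [(hμB0 0 v).le, zero_le_one, le_rfl]
    · rw [hMB]; dsimp only
      by_cases hk : k = 0
      · simp only [hk, if_true]; exact hμB1 0
      · simp only [hk, if_false]; rw [Finset.sum_ite_eq univ u, if_pos (mem_univ _)]
  have hMBrev : ∀ k, DetailedBalance (μB k) (MB k) := fun k => by
    intro u v
    rw [hMB]; dsimp only
    by_cases hk : k = 0
    · subst hk; simp only [if_true]; ring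
    · simp only [hk, if_false]
      by_cases huv : u = v
      · subst huv; rfl
      · rw [if_neg huv, if_neg (Ne.symm huv), mul_zero, mul_zero]
  have hMB0 : ∀ u v, MB 0 u v = μB 0 v := fun u v => by rw [hMB]; simp
  have hP := weightedScheme_isRowStochastic (ptGraphSwap_isRowStochastic (e := fun r : Fin m =>
      (((0 : Fin (K + 1)), (κ r).succ) : Fin (K + 1) × Fin (K + 1))) (φ := fun _ : Fin m => Equiv.refl L) hμB0) hMBs hw0 hw1 ht0.le ht1.le
  have hDB := weightedScheme_detailedBalance (w := w) (ptGraphSwap_detailedBalance (e := fun r : Fin m =>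
      (((0 : Fin (K + 1)), (κ r).succ) : Fin (K + 1) × Fin (K + 1))) (φ := fun _ : Fin m => Equiv.refl L) hμB0) hMBrev t
  have hirr := dominatedStar_isIrreducible_regimeFree κ (fun _ : Fin m => Equiv.refl L) (μ := μB) (M := MB) ht0 ht1 hw0 hw00 hw1 hμB0
    hMBs hMB0 hc1 hc
  have hgap := dominatedStar_absSpectralGap_ge_regimeFree κ (fun _ : Fin m => Equiv.refl L) (μ := μB) (M := MB) hK hm ht0 ht1 hw0 hw00
    hw1 hμB0 hμB1 hMBs hMBrev hMB0 hp0 hp1 hdomB hc1 hc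
  have hd := worstTvDist_le_lambdaStar_pow_div (tensorFun_pos hμB0) (sum_tensorFun_eq_one μB hμB1) hP hDB hirr hmin0 hmin n
  have hlam0 := lambdaStar_nonneg (fun y s : Fin (K + 1) → L =>
        t * ptGraphSwap μB (fun r : Fin m => (((0 : Fin (K + 1)), (κ r).succ) : Fin (K + 1) × Fin (K + 1)))
            (fun _ : Fin m => Equiv.refl L) y s + (1 - t) * prodKernel w MB y s)
  have hlam1 : lambdaStar (fun y s : Fin (K + 1) → L =>
        t * ptGraphSwap μB (fun r : Fin m => (((0 : Fin (K + 1)), (κ r).succ) : Fin (K + 1) × Fin (K + 1)))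
            (fun _ : Fin m => Equiv.refl L) y s + (1 - t) * prodKernel w MB y s)
      ≤ 1 - p * min (c * t / (3 * m)) ((1 - t) * w 0 / (7 * K)) := by
    unfold absSpectralGap at hgap; linarith
  calc _ ≤ _ := hd
    _ ≤ (1 - p * min (c * t / (3 * m)) ((1 - t) * w 0 / (7 * K))) ^ n / (2 * πLmin) :=
        div_le_div_of_nonneg_right (pow_le_pow_left₀ hlam0 hlam1 n) (by positivity)

/-- **THE COLD-START LAW WITH PARTITION-EXACT FLOWS AND ANY NUMBER OF SECTORS (`|L| ≥ 2`, `K ≥ 1`):**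
**`d(n) ≤ ((θ+K)/θ)(1 − min{(1−t)w_0(1−θ)pct/m, ((1−t)w_0θ−(1−θ)t)/(K+θ)})^{⌊n/2⌋} + (1 − p·min{ct/(3m), (1−t)w_0/(7K)})ⁿ/(2π̃^L_min)`** — free
of `|S|`, of `π̃_min` and of any regime; `π̃^L_min` is any positive lower bound of the stationary mass of a LABEL configuration. [ours] -/
theorem sectorExact_worstTvDist_le_manySectors [Nontrivial L] (hK : 1 ≤ K) (hm : 1 ≤ m) (ht0 : 0 < t) (ht1 : t < 1) (hw0 : ∀ k, 0 ≤ w k)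
    (hw00 : 0 < w 0) (hw1 : ∑ k, w k = 1) (hμ : ∀ k x, 0 < μ k x) (hμ1 : ∀ k, ∑ u, μ k u = 1) (hφℓ : ∀ r u, ℓ (φ r u) = ℓ u)
    {cL : Fin m → L → ℝ} (hcL : ∀ r b, 0 < cL r b) (hexact : ∀ r u, μ (κ r).succ (φ r u) = cL r (ℓ u) * μ 0 u)
    (hM : ∀ k, IsRowStochastic (M k)) (hM0 : ∀ u v, M 0 u v = μ 0 v)
    (hstat : ∀ k : Fin (K + 1), k ≠ 0 → ∀ v, ∑ u, μ k u * M k u v = μ k v)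
    (hconf : ∀ k : Fin (K + 1), k ≠ 0 → ∀ u v, ℓ u ≠ ℓ v → M k u v = 0)
    {μB : Fin (K + 1) → L → ℝ} (hμB : ∀ k b, μB k b = ∑ u ∈ univ.filter (fun u => ℓ u = b), μ k u)
    (hμB0 : ∀ k b, 0 < μB k b) {p θ : ℝ} (hp0 : 0 < p) (hp1 : p ≤ 1) (hpc : ∀ r b, p * cL r b ≤ 1) (hθ0 : 0 < θ) (hθ1 : θ ≤ 1)
    (hreg : (1 - θ) * t ≤ (1 - t) * w 0 * θ) {c : ℕ} (hc1 : 1 ≤ c) (hc : ∀ p' : Fin K, c ≤ (univ.filter (fun r : Fin m => κ r = p')).card)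
    {πLmin : ℝ} (hmin0 : 0 < πLmin) (hmin : ∀ s, πLmin ≤ tensorFun μB s) (n : ℕ) :
    worstTvDist (fun y z : Fin (K + 1) → S =>
        t * ptGraphSwap μ (fun r : Fin m => (((0 : Fin (K + 1)), (κ r).succ) : Fin (K + 1) × Fin (K + 1))) φ y z
          + (1 - t) * prodKernel w M y z) (tensorFun μ) n
      ≤ (θ + K) / θ * (1 - min ((1 - t) * w 0 * (1 - θ) * p * c * t / m) (((1 - t) * w 0 * θ - (1 - θ) * t) / (K + θ))) ^ (n / 2)
        + (1 - p * min (c * t / (3 * m)) ((1 - t) * w 0 / (7 * K))) ^ n / (2 * πLmin) := by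
  obtain ⟨hμB1, -, -, -, hdomB⟩ := labelStar_basic κ φ ℓ hμ1 hφℓ hexact hμB hμB0 hpc
  have h1 := sectorExact_worstTvDist_le_labelStar_dom κ φ ℓ hm ht0.le ht1.le hw0 hw1 hμ hμ1 hφℓ hcL hexact hM hM0 hstat hconf hμB hμB0
    hp0.le hpc hθ0 hθ1 hreg hc n
  have h2 := labelStar_worstTvDist_le_dom κ hK hm ht0 ht1 hw0 hw00 hw1 hμB0 hμB1 hp0 hp1 hdomB hc1 hc hmin0 hmin n
  linarith [h1, h2]

/-- **THE MIXING TIME WITH PARTITION-EXACT FLOWS AND ANY NUMBER OF SECTORS** (`θ = 2t/(2t+h)`, `h = (1−t)w_0`):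
**`t_mix(ε) ≤ max{2⌈ρ⁻¹·log(2(1+K(2t+h)/(2t))/ε)⌉, ⌈(p·min{ct/(3m), h/(7K)})⁻¹·log(1/(ε·π̃^L_min))⌉}`**, `ρ = (th/(2t+h))·min{hpc/m, 1/(K+1)}` —
`O((K + m/(hpc))(1/t + 1/h)log(K/ε) + (m/(ctp) + K/(hp))·log(1/(ε·π̃^L_min)))`, with `log(1/π̃^L_min) ≤ (K+1)log(1/w_min)` for the least sector weight
`w_min`: polynomial in `K`, linear in `1/p`, free of `|S|` and of any regime. [ours] -/
theorem sectorExact_mixingTime_le_manySectors [Nontrivial L] (hK : 1 ≤ K) (hm : 1 ≤ m) (ht0 : 0 < t) (ht1 : t < 1) (hw0 : ∀ k, 0 ≤ w k)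
    (hw00 : 0 < w 0) (hw1 : ∑ k, w k = 1) (hμ : ∀ k x, 0 < μ k x) (hμ1 : ∀ k, ∑ u, μ k u = 1) (hφℓ : ∀ r u, ℓ (φ r u) = ℓ u)
    {cL : Fin m → L → ℝ} (hcL : ∀ r b, 0 < cL r b) (hexact : ∀ r u, μ (κ r).succ (φ r u) = cL r (ℓ u) * μ 0 u)
    (hM : ∀ k, IsRowStochastic (M k)) (hM0 : ∀ u v, M 0 u v = μ 0 v)
    (hstat : ∀ k : Fin (K + 1), k ≠ 0 → ∀ v, ∑ u, μ k u * M k u v = μ k v)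
    (hconf : ∀ k : Fin (K + 1), k ≠ 0 → ∀ u v, ℓ u ≠ ℓ v → M k u v = 0)
    {μB : Fin (K + 1) → L → ℝ} (hμB : ∀ k b, μB k b = ∑ u ∈ univ.filter (fun u => ℓ u = b), μ k u)
    (hμB0 : ∀ k b, 0 < μB k b) {p : ℝ} (hp0 : 0 < p) (hp1 : p ≤ 1) (hpc : ∀ r b, p * cL r b ≤ 1)
    {c : ℕ} (hc1 : 1 ≤ c) (hc : ∀ p' : Fin K, c ≤ (univ.filter (fun r : Fin m => κ r = p')).card)
    {πLmin : ℝ} (hmin0 : 0 < πLmin) (hmin : ∀ s, πLmin ≤ tensorFun μB s) {ε : ℝ} (hε : 0 < ε) :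
    mixingTime (fun y z : Fin (K + 1) → S =>
        t * ptGraphSwap μ (fun r : Fin m => (((0 : Fin (K + 1)), (κ r).succ) : Fin (K + 1) × Fin (K + 1))) φ y z
          + (1 - t) * prodKernel w M y z) (tensorFun μ) ε
      ≤ max (2 * ⌈1 / (t * ((1 - t) * w 0) / (2 * t + (1 - t) * w 0) * min ((1 - t) * w 0 * p * c / m) (1 / (K + 1)))
              * Real.log (2 * (1 + K * (2 * t + (1 - t) * w 0) / (2 * t)) / ε)⌉₊)
          ⌈1 / (p * min (c * t / (3 * m)) ((1 - t) * w 0 / (7 * K))) * Real.log (1 / πLmin / ε)⌉₊ := by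
  set h := (1 - t) * w 0 with hh
  have hh0 : 0 < h := mul_pos (by linarith) hw00
  have hmpos : (0 : ℝ) < m := Nat.cast_pos.mpr (by omega)
  have hKr : (1 : ℝ) ≤ K := by exact_mod_cast hK
  have hcpos : (0 : ℝ) < c := Nat.cast_pos.mpr (by omega)
  -- the tuned `θ`
  set θ := 2 * t / (2 * t + h) with hθ
  have hθ0 : 0 < θ := by positivity
  have hθ1 : θ ≤ 1 := by rw [hθ, div_le_one (by positivity)]; linarith
  have h1θ : 1 - θ = h / (2 * t + h) := by rw [hθ]; field_simp; ring
  have hreg : (1 - θ) * t ≤ (1 - t) * w 0 * θ := by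
    rw [h1θ, ← hh, hθ]
    rw [div_mul_eq_mul_div, mul_div_assoc', div_le_div_iff_of_pos_right (by positivity)]
    nlinarith [mul_pos ht0 hh0]
  -- the two rates
  set ρ := t * h / (2 * t + h) * min (h * p * c / m) (1 / (K + 1)) with hρ
  have hρ0 : 0 < ρ := by
    have : 0 < min (h * p * c / (m : ℝ)) (1 / ((K : ℝ) + 1)) := lt_min (by positivity) (by positivity)
    positivity
  have hρ1 : ρ ≤ 1 := by
    have h1 : t * h / (2 * t + h) ≤ 1 := by rw [div_le_one (by positivity)]; nlinarith [mul_pos ht0 hh0]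
    have h2 : min (h * p * c / (m : ℝ)) (1 / ((K : ℝ) + 1)) ≤ 1 := (min_le_right _ _).trans (by
      rw [div_le_one (by positivity)]; linarith [Nat.cast_nonneg (α := ℝ) K])
    have h3 : 0 ≤ min (h * p * c / (m : ℝ)) (1 / ((K : ℝ) + 1)) := le_min (by positivity) (by positivity)
    calc ρ ≤ 1 * 1 := mul_le_mul h1 h2 h3 zero_le_one
      _ = 1 := one_mul 1
  set G := p * min (c * t / (3 * m)) (h / (7 * K)) with hG
  have hG0 : 0 < G := mul_pos hp0 (lt_min (by positivity) (by positivity))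
  have hG1 : G ≤ 1 := by
    have h1 : min (c * t / (3 * m)) (h / (7 * K)) ≤ 1 := (min_le_right _ _).trans (by
      rw [div_le_one (by positivity)]
      have hw01 : w 0 ≤ 1 := by
        calc w 0 ≤ ∑ k, w k := Finset.single_le_sum (fun k _ => hw0 k) (mem_univ 0)
          _ = 1 := hw1
      nlinarith [mul_le_mul_of_nonneg_left hw01 (sub_nonneg.mpr ht1.le)])
    have h0 : 0 ≤ min (c * t / (3 * m)) (h / (7 * K)) := le_min (by positivity) (by positivity)
    calc G ≤ 1 * 1 := mul_le_mul hp1 h1 h0 zero_le_one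
      _ = 1 := one_mul 1
  set C₁ := 1 + K * (2 * t + h) / (2 * t) with hC₁
  have hC₁0 : 0 < C₁ := by positivity
  set N₁ : ℕ := ⌈1 / ρ * Real.log (2 * C₁ / ε)⌉₊ with hN₁
  set N₂ : ℕ := ⌈1 / G * Real.log (1 / πLmin / ε)⌉₊ with hN₂
  set n : ℕ := max (2 * N₁) N₂ with hn
  -- the law at time `n`
  have hlaw := sectorExact_worstTvDist_le_manySectors κ φ ℓ hK hm ht0 ht1 hw0 hw00 hw1 hμ hμ1 hφℓ hcL hexact hM hM0 hstat hconf hμB hμB0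
    hp0 hp1 hpc hθ0 hθ1 hreg hc1 hc hmin0 hmin n
  -- compare the stale rate with `ρ` and the constant with `C₁`
  have hrate : ρ ≤ min ((1 - t) * w 0 * (1 - θ) * p * c * t / m) (((1 - t) * w 0 * θ - (1 - θ) * t) / (K + θ)) := by
    refine le_min ?_ ?_
    · calc ρ ≤ t * h / (2 * t + h) * (h * p * c / m) := mul_le_mul_of_nonneg_left (min_le_left _ _) (by positivity)
        _ = (1 - t) * w 0 * (1 - θ) * p * c * t / m := by rw [h1θ, ← hh]; ring
    · calc ρ ≤ t * h / (2 * t + h) * (1 / (K + 1)) := mul_le_mul_of_nonneg_left (min_le_right _ _) (by positivity)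
        _ ≤ t * h / (2 * t + h) * (1 / (K + θ)) := by gcongr
        _ = ((1 - t) * w 0 * θ - (1 - θ) * t) / (K + θ) := by rw [← hh, h1θ, hθ]; field_simp; ring
  have hconst : (θ + K) / θ = C₁ := by rw [hC₁, hθ]; field_simp
  have hbase0 : 0 ≤ 1 - min ((1 - t) * w 0 * (1 - θ) * p * c * t / m) (((1 - t) * w 0 * θ - (1 - θ) * t) / (K + θ)) := by
    have h2 : min ((1 - t) * w 0 * (1 - θ) * p * c * t / m) (((1 - t) * w 0 * θ - (1 - θ) * t) / (K + θ))
        ≤ ((1 - t) * w 0 * θ - (1 - θ) * t) / (K + θ) := min_le_right _ _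
    have h3 : ((1 - t) * w 0 * θ - (1 - θ) * t) / (K + θ) ≤ 1 := by
      rw [div_le_one (by positivity)]
      have hw01 : w 0 ≤ 1 := by
        calc w 0 ≤ ∑ k, w k := Finset.single_le_sum (fun k _ => hw0 k) (mem_univ 0)
          _ = 1 := hw1
      nlinarith [mul_nonneg (sub_nonneg.mpr ht1.le) (hw0 0), mul_nonneg (sub_nonneg.mpr hθ1) ht0.le, hθ0.le,
        mul_le_mul_of_nonneg_left hw01 (sub_nonneg.mpr ht1.le), Nat.cast_nonneg (α := ℝ) K]
    linarith
  -- first term `≤ ε/2`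
  have hn1 : N₁ ≤ n / 2 := by omega
  have hfirst : (θ + K) / θ * (1 - min ((1 - t) * w 0 * (1 - θ) * p * c * t / m)
      (((1 - t) * w 0 * θ - (1 - θ) * t) / (K + θ))) ^ (n / 2) ≤ ε / 2 := by
    have hg := geom_le_of_ge_log hρ0 hρ1 (by positivity : 0 < 2 * C₁) hε (n := N₁) (Nat.le_ceil _)
    calc (θ + K) / θ * (1 - min ((1 - t) * w 0 * (1 - θ) * p * c * t / m) (((1 - t) * w 0 * θ - (1 - θ) * t) / (K + θ))) ^ (n / 2)
        ≤ C₁ * (1 - ρ) ^ (n / 2) := by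
          rw [hconst]
          exact mul_le_mul_of_nonneg_left (pow_le_pow_left₀ hbase0 (by linarith [hrate]) _) hC₁0.le
      _ ≤ C₁ * (1 - ρ) ^ N₁ := mul_le_mul_of_nonneg_left (pow_le_pow_of_le_one (by linarith) (by linarith) hn1) hC₁0.le
      _ = (2 * C₁ * (1 - ρ) ^ N₁) / 2 := by ring
      _ ≤ ε / 2 := by linarith [hg]
  -- second term `≤ ε/2`
  have hn2 : N₂ ≤ n := le_max_right _ _
  have hsecond : (1 - p * min (c * t / (3 * m)) ((1 - t) * w 0 / (7 * K))) ^ n / (2 * πLmin) ≤ ε / 2 := by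
    have hg := geom_le_of_ge_log hG0 hG1 (by positivity : 0 < 1 / πLmin) hε (n := N₂) (Nat.le_ceil _)
    rw [← hh]
    calc (1 - G) ^ n / (2 * πLmin) ≤ (1 - G) ^ N₂ / (2 * πLmin) :=
          div_le_div_of_nonneg_right (pow_le_pow_of_le_one (by linarith) (by linarith) hn2) (by positivity)
      _ = (1 / πLmin * (1 - G) ^ N₂) / 2 := by field_simp
      _ ≤ ε / 2 := by linarith [hg]
  refine mixingTime_le _ _ (t₀ := n) (hlaw.trans ?_)
  linarith [hfirst, hsecond]

end ManySectors

end Summit.Ventures.LatticeQCDFlow.Scaling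

end
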